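import Literature.MathematicalPhysics.QuantumFieldTheory.Federbush1986.SimplyConnectedNormalGeneration
import Literature.MathematicalPhysics.QuantumFieldTheory.Federbush1986.PuncturedBlockPeeling
import Literature.MathematicalPhysics.QuantumFieldTheory.Federbush1986.SimplyConnectedNotDimTwo

/-!
# Federbush [F3] §5.3 1)–3) p. 303: simple connectivity FROM PEELABILITY — staircases of boxes with a common corner (any family,
# any dimension; in particular the whole orthant), and the punctured block once more through its extended axial gauge

statement-level skeleton of published theorems with citation tags; proofs where landed; nothing here is a claim about the Yang–Mills mass gap

SOURCE. [Federbush1987PhaseCellIII] P. Federbush, *A phase cell approach to Yang–Mills theory III. Local stability, modified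
renormalization group transformation*, Commun. Math. Phys. **110** (1987) 293–309, §5.3 1)–3) p. 303 (text layer
`…/texts/fed1987-cmp110-III/p011.txt` L14–L33), verbatim: *«Inside each N⁴ block, the vertices and bonds not in any of the balls
includes a large connected set of bonds and vertices, the major block sublattice. … The union of the four major block sublattices
naturally combine to form the major sublattice, a connected lattice … 2) We will say a lattice is simply connected if every closed
contour can be modified to a trivial contour (a point) by a sequence of elementary homotopies. … By removing ≦ c₄ vertices and bonds
each major block sublattice and the major sublattice may be made simply connected and connected. (This could not be done in two
dimensions.) … 3) The bonds assigned ε inside a block in the Balaban axial gauge will also be assigned ε in the nice block sublattice.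
… We assign ε to a sufficient number of additional bonds to define an axial gauge in each nice block.»*

CITATION HEADER (lean-in-tree rule).  lit-balaban cell (HOME `run/shared/lean/pub/lit-balaban/`), Phase-2 proof seat p26 (gen 12;
free-target protocol G.5-34(d)), SKELETON row **F3.Eq5.26-5.40** (§5.3, head `absent`; owner r17, referee ref-5).  Third file of this
gen: applies `SimplyConnectedNormalGeneration.simplyConnected_of_peeling` (peelable + spanning forest gauge + orientation-closed
plaquettes ⇒ simply connected) to the peelings of `PeelingObservation` (`staircasePeeling`, gen 11) and `PuncturedBlockPeeling`
(`nicePeeling`, gen 11).  p32's `SimplyConnectedUnion` (p311561: discrete Seifert–van Kampen, two pieces) and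
`SimplyConnectedBoxMinusBox` (p311995: the punctured block by slabs) are the results these corollaries parallel BY A DIFFERENT ROUTE;
neither is used; p32's `SimplyConnectedNotDimTwo` (p309857) is used in §4.

WHAT IS PROVED.
* §1 STAIRCASES: for ANY family of boxes `[lo, hi i]` (`i : ι`, any index type, any `d`) with a common lower corner — the union of
  their combs is a FOREST (`isForest_iUnion_combTree`: potential `Σ_i x_i`, `endpt_inj_of_common_corner`) spanning the union from
  `lo` (`spans_iUnion_combTree`), the union of their plaquette sets is orientation-closed, so by the staircase peeling
  **`simplyConnected_staircase : SimplyConnected (⋃ i, boxPlaq lo (hi i)) (⋃ i, boxBonds lo (hi i))`** — L-shapes, towers, a box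
  minus a corner sub-box, and infinite unions; with `generated_staircase` / `normallyGenerated_staircase` (the Observation for every
  group, flat and full, in the union-of-combs gauge).
* §2 THE ORTHANT `{x ≧ lo}`: its bonds and plaquettes are the union over all `hi` of those of the boxes `[lo, hi]`
  (`orthantBonds_eq_iUnion`, `orthantPlaq_eq_iUnion`), whence **`simplyConnected_orthant`** and `generated_orthant` — an infinite
  sub-lattice, simply connected in print's sense, on which the comb gauge determines the bond variables from the plaquette variables
  for every group.
* §3 THE PUNCTURED BLOCK `[lo, hi] ∖ [klo, khi] ⊂ ℤ^{n+3}` (hole in the interior): the extended axial gauge `niceTree` of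
  `PuncturedBlockPeeling` is a FOREST (`isForest_niceTree`: the only gauge bond entering a first-shadow-layer site is its connector),
  the punctured plaquette set is orientation-closed, so by `nicePeeling` + `spans_niceTree`
  **`simplyConnected_boxMinusBox'`** — p32's `simplyConnected_boxMinusBox` RE-DERIVED through the peeling («we assign ε to a
  sufficient number of additional bonds to define an axial gauge in each nice block» ⇒ «simply connected»), for `d = n + 3 ≥ 3`.

* §4 «(This could not be done in two dimensions.)» in the peeling reading: a lattice that is NOT simply connected is not normally
  generated and NOT PEELABLE in any spanning forest gauge (`isEmpty_peeling_of_not_simplyConnected`); with p32's winding-number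
  theorem `not_simplyConnected_puncturedPlane`: **`isEmpty_peeling_puncturedPlane`** — no forest spanning `ℤ²` peels the plane
  with the four plaquettes at `z₀` removed, `not_normallyGenerated_puncturedPlane`.

HONEST SCOPE.  Corollaries of the machine of `SimplyConnectedNormalGeneration` for the concrete gauges of this directory; the nice
block of print (several balls, ≦ c₄ further removals) is modelled, as before, by one interior box removed (§3) or by staircases (§1).
Definitions with bodies only (`orthantBonds`, `orthantPlaq`); everything else is a theorem; no `sorry`, axioms standard.  Unit
`lit-balaban-p26` (literature-prover-lit-balaban-p26-g12-0).
-/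

namespace Literature.MathematicalPhysics.QuantumFieldTheory.Federbush1986

namespace ObservationCriterion

open LatticeContour SimplyConnectedBox CombGaugeObservation PeelingObservation

variable {d : ℕ}

/-! ## §1 Staircases: unions of boxes with a common corner -/

section Staircase

variable {ι : Sort*}

/-- Comb bonds of boxes with the SAME lower corner entering the same site coincide (the bond entering `y` is `⟨y − e_μ, y⟩` with `μ`
the largest direction in which `y` differs from the corner). [cite: Federbush1987PhaseCellIII, §5.3 2)–3) p. 303] -/
theorem endpt_inj_of_common_corner {lo hi hi' : Site d} {b b' : Bond d} (hb : b ∈ combTree lo hi) (hb' : b' ∈ combTree lo hi')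
    (he : b.1 + ev b.2 = b'.1 + ev b'.2) : b = b' := by
  obtain ⟨x, μ⟩ := b
  obtain ⟨x', μ'⟩ := b'
  have he' : x + ev μ = x' + ev μ' := he
  rcases lt_trichotomy μ μ' with h | h | h
  · exfalso
    have h1 : (x + ev μ) μ' = (x' + ev μ') μ' := by rw [he']
    rw [add_ev_apply, add_ev_apply, if_neg (ne_of_gt h), if_pos rfl, add_zero] at h1
    have h2 := (mem_combTree.1 hb).2 μ' h
    have h3 : lo μ' ≤ x' μ' ∧ x' μ' ≤ hi' μ' := mem_boxSites.1 (fst_mem_boxSites (mem_combTree.1 hb').1) μ'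
    dsimp only at h2
    omega
  · subst h
    have : x = x' := add_right_cancel he'
    rw [this]
  · exfalso
    have h1 : (x + ev μ) μ = (x' + ev μ') μ := by rw [he']
    rw [add_ev_apply, add_ev_apply, if_pos rfl, if_neg (ne_of_gt h), add_zero] at h1
    have h2 := (mem_combTree.1 hb').2 μ h
    have h3 : lo μ ≤ x μ ∧ x μ ≤ hi μ := mem_boxSites.1 (fst_mem_boxSites (mem_combTree.1 hb).1) μ
    dsimp only at h2
    omega

/-- The coordinate sum increases by one along every bond. [cite: Federbush1987PhaseCellIII, §5.1 p. 300] -/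
theorem coordSum_add_ev (x : Site d) (μ : Fin d) : (∑ i, (x + ev μ) i) = (∑ i, x i) + 1 := by
  simp only [Pi.add_apply, Finset.sum_add_distrib, ev, add_right_inj]
  rw [Finset.sum_pi_single']
  simp

/-- **The union of the combs of boxes with a common corner is a forest.** [cite: Federbush1987PhaseCellIII, §5.3 2)–3) p. 303] -/
theorem isForest_iUnion_combTree (lo : Site d) (hi : ι → Site d) : IsForest (⋃ i, combTree lo (hi i)) := by
  refine isForest_of_potential (fun x => ∑ i, x i) (fun b _ => coordSum_add_ev b.1 b.2) fun b hb b' hb' h => ?_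
  obtain ⟨i, hi1⟩ := Set.mem_iUnion.1 hb
  obtain ⟨i', hi2⟩ := Set.mem_iUnion.1 hb'
  exact endpt_inj_of_common_corner hi1 hi2 h

/-- The union of the combs spans the union of the boxes from the common corner. [cite: Federbush1987PhaseCellIII, §5.3 2)–3) p. 303] -/
theorem spans_iUnion_combTree (lo : Site d) (hi : ι → Site d) :
    Spans (⋃ i, combTree lo (hi i)) (⋃ i, boxBonds lo (hi i)) lo := by
  intro l hl
  obtain ⟨i, hli⟩ := Set.mem_iUnion.1 hl
  obtain ⟨τ, hτ, hT⟩ := spans_combTree lo (hi i) l hli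
  exact ⟨τ, hτ, fun l' hl' => Set.mem_iUnion.2 ⟨i, hT l' hl'⟩⟩

/-- The plaquettes of a union of boxes are closed under reversing orientation. [cite: Federbush1987PhaseCellIII, §5.3 2) p. 303] -/
theorem swap_mem_iUnion_boxPlaq {lo : Site d} {hi : ι → Site d} {p : LatticeContour.Plaq d} (hp : p ∈ ⋃ i, boxPlaq lo (hi i)) :
    (p.1, p.2.2, p.2.1) ∈ ⋃ i, boxPlaq lo (hi i) := by
  obtain ⟨i, hpi⟩ := Set.mem_iUnion.1 hp
  exact Set.mem_iUnion.2 ⟨i, swap_mem_boxPlaq hpi⟩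

/-- **Staircases are simply connected**: any union of boxes of `ℤ^d` with a common lower corner (an `L`-shape, a tower of boxes, a
box minus its top-corner sub-box, an infinite staircase, …) is simply connected in print's sense — through the staircase peeling
of `PeelingObservation`. [cite: Federbush1987PhaseCellIII, §5.3 1)–3) p. 303] -/
theorem simplyConnected_staircase (lo : Site d) (hi : ι → Site d) :
    SimplyConnected (⋃ i, boxPlaq lo (hi i)) (⋃ i, boxBonds lo (hi i)) :=
  simplyConnected_of_peeling (staircasePeeling lo hi) (Set.iUnion_mono fun i => combTree_subset lo (hi i))
    (spans_iUnion_combTree lo hi) (isForest_iUnion_combTree lo hi) fun _ hp => swap_mem_iUnion_boxPlaq hp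

/-- On a staircase the based plaquette words GENERATE (union-of-combs gauge): the Observation there holds for every group.
[cite: Federbush1987PhaseCellIII, §5.3 2)–3) Observation p. 303] -/
theorem generated_staircase (lo : Site d) (hi : ι → Site d) :
    Generated (⋃ i, boxPlaq lo (hi i)) (⋃ i, boxBonds lo (hi i)) (⋃ i, combTree lo (hi i)) :=
  generated_of_peeling (staircasePeeling lo hi)

/-- … hence normally generate. [cite: Federbush1987PhaseCellIII, §5.3 2) p. 303] -/
theorem normallyGenerated_staircase (lo : Site d) (hi : ι → Site d) :
    NormallyGenerated (⋃ i, boxPlaq lo (hi i)) (⋃ i, boxBonds lo (hi i)) (⋃ i, combTree lo (hi i)) :=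
  (generated_staircase lo hi).normallyGenerated

end Staircase

/-! ## §2 The orthant `{x ≧ lo}` -/

section Orthant

/-- The bonds of the orthant `{x ∈ ℤ^d : x ≧ lo}` (both endpoints in it). [cite: Federbush1987PhaseCellIII, §5.3 1) p. 303] -/
def orthantBonds (lo : Site d) : Set (Bond d) := {b | ∀ i, lo i ≤ b.1 i}

/-- The plaquettes of the orthant (genuine squares with all corners in it). [cite: Federbush1987PhaseCellIII, §5.3 2) p. 303] -/
def orthantPlaq (lo : Site d) : Set (LatticeContour.Plaq d) := {p | p.2.1 ≠ p.2.2 ∧ ∀ i, lo i ≤ p.1 i}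

/-- Membership in the bonds of the orthant. [cite: Federbush1987PhaseCellIII, §5.3 1) p. 303] -/
theorem mem_orthantBonds {lo : Site d} {b : Bond d} : b ∈ orthantBonds lo ↔ ∀ i, lo i ≤ b.1 i := Iff.rfl

/-- Membership in the plaquettes of the orthant. [cite: Federbush1987PhaseCellIII, §5.3 2) p. 303] -/
theorem mem_orthantPlaq {lo : Site d} {p : LatticeContour.Plaq d} : p ∈ orthantPlaq lo ↔ p.2.1 ≠ p.2.2 ∧ ∀ i, lo i ≤ p.1 i :=
  Iff.rfl

/-- Coordinates only grow along `e_μ`. [cite: Federbush1987PhaseCellIII, §5.1 p. 300] -/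
theorem le_add_ev_apply (x : Site d) (μ i : Fin d) : x i ≤ (x + ev μ) i := by
  rw [add_ev_apply]; split_ifs <;> omega

/-- The orthant is the staircase of ALL boxes with corner `lo`: bonds. [cite: Federbush1987PhaseCellIII, §5.3 1) p. 303] -/
theorem orthantBonds_eq_iUnion (lo : Site d) : orthantBonds lo = ⋃ hi : Site d, boxBonds lo hi := by
  ext ⟨x, μ⟩
  simp only [mem_orthantBonds, Set.mem_iUnion, mem_boxBonds, mem_boxSites]
  constructor
  · intro h
    exact ⟨x + ev μ, fun i => ⟨h i, le_add_ev_apply x μ i⟩, fun i => ⟨(h i).trans (le_add_ev_apply x μ i), le_rfl⟩⟩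
  · rintro ⟨hi, h1, -⟩ i
    exact (h1 i).1

/-- The orthant is the staircase of ALL boxes with corner `lo`: plaquettes. [cite: Federbush1987PhaseCellIII, §5.3 2) p. 303] -/
theorem orthantPlaq_eq_iUnion (lo : Site d) : orthantPlaq lo = ⋃ hi : Site d, boxPlaq lo hi := by
  ext ⟨z, μ, ν⟩
  simp only [mem_orthantPlaq, Set.mem_iUnion, mem_boxPlaq, mem_boxSites]
  constructor
  · rintro ⟨hne, h⟩
    refine ⟨z + ev μ + ev ν, hne, fun i => ⟨h i, ?_⟩, fun i => ⟨?_, le_rfl⟩⟩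
    · exact (le_add_ev_apply z μ i).trans (le_add_ev_apply _ ν i)
    · exact ((h i).trans (le_add_ev_apply z μ i)).trans (le_add_ev_apply _ ν i)
  · rintro ⟨hi, hne, h1, -⟩
    exact ⟨hne, fun i => (h1 i).1⟩

/-- **The orthant is simply connected** (an infinite sub-lattice of `ℤ^d`, every `d`). [cite: Federbush1987PhaseCellIII, §5.3 2) p. 303] -/
theorem simplyConnected_orthant (lo : Site d) : SimplyConnected (orthantPlaq lo) (orthantBonds lo) := by
  rw [orthantBonds_eq_iUnion, orthantPlaq_eq_iUnion]
  exact simplyConnected_staircase lo id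

/-- On the orthant the comb gauge (all combs with corner `lo`) generates: the Observation holds there for every group.
[cite: Federbush1987PhaseCellIII, §5.3 2)–3) Observation p. 303] -/
theorem generated_orthant (lo : Site d) :
    Generated (orthantPlaq lo) (orthantBonds lo) (⋃ hi : Site d, combTree lo hi) := by
  rw [orthantBonds_eq_iUnion, orthantPlaq_eq_iUnion]
  exact generated_staircase lo id

end Orthant

/-! ## §3 The punctured block through its extended axial gauge -/

section Punctured

open PuncturedBlockPeeling SimplyConnectedBoxMinusBox

variable {n : ℕ} {lo hi klo khi : Site (n + 3)}

/-- **The extended axial gauge of the punctured block is a forest**: potential `Σ_i x_i`; two gauge bonds entering the same site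
coincide — comb bonds by `endpt_inj_of_common_corner`, connectors trivially, and a comb bond of the punctured block never enters a
first-shadow-layer site above the hole (it would run in the top direction and start inside the hole).
[cite: Federbush1987PhaseCellIII, §5.3 3) p. 303] -/
theorem isForest_niceTree (hK : ∀ i, lo i < klo i ∧ klo i ≤ khi i ∧ khi i < hi i) : IsForest (niceTree lo hi klo khi) := by
  refine isForest_of_potential (fun x => ∑ i, x i) (fun b _ => coordSum_add_ev b.1 b.2) fun b hb b' hb' h => ?_
  have key : ∀ {c c' : Bond (n + 3)}, c ∈ puncturedBonds lo hi klo khi → c ∈ combTree lo hi → IsConn klo khi c' →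
      c.1 + ev c.2 = c'.1 + ev c'.2 → False := by
    rintro ⟨x, μ⟩ ⟨x', μ'⟩ hc hcomb ⟨hμ', hlev, hcol⟩ he
    dsimp only at hμ' hlev hcol he hc
    subst hμ'
    have hτ0 : (Fin.last (n + 2) : Fin (n + 3)) ≠ 0 := (zero_ne_top (n := n)).symm
    have hyτ : (x + ev μ) (Fin.last (n + 2)) = khi (Fin.last (n + 2)) + 1 := by rw [he, addE_ne x' hτ0, hlev]
    have hμ : μ = Fin.last (n + 2) := by
      by_contra hne
      have hlt : μ < Fin.last (n + 2) := lt_top_of_ne hne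
      have h1 : x (Fin.last (n + 2)) = lo (Fin.last (n + 2)) := (mem_combTree.1 hcomb).2 _ hlt
      rw [addE_ne x (ne_of_gt hlt)] at hyτ
      have h2 := hK (Fin.last (n + 2))
      omega
    subst hμ
    rw [addE_self] at hyτ
    apply hc.2.1
    show x ∈ boxSites klo khi
    rw [mem_hole_iff]
    have hcol' : ColK klo khi (x + ev (Fin.last (n + 2))) := by rw [he]; exact hcol
    refine ⟨(colK_congr fun i hi => addE_ne x hi).1 hcol', ?_, ?_⟩
    · have h2 := hK (Fin.last (n + 2)); omega
    · omega
  rcases hb.2 with hbc | hbC <;> rcases hb'.2 with hbc' | hbC'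
  · exact endpt_inj_of_common_corner hbc hbc' h
  · exact (key hb.1 hbc hbC' h).elim
  · exact (key hb'.1 hbc' hbC h.symm).elim
  · obtain ⟨x, μ⟩ := b
    obtain ⟨x', μ'⟩ := b'
    have h1 : μ = 0 := hbC.1
    have h2 : μ' = 0 := hbC'.1
    subst h1; subst h2
    have h3 : x + ev 0 = x' + ev 0 := h
    rw [add_right_cancel h3]

/-- The plaquettes of the punctured block are closed under reversing orientation. [cite: Federbush1987PhaseCellIII, §5.3 2) p. 303] -/
theorem swap_mem_puncturedPlaq {p : LatticeContour.Plaq (n + 3)} (hp : p ∈ puncturedPlaq lo hi klo khi) :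
    (p.1, p.2.2, p.2.1) ∈ puncturedPlaq lo hi klo khi := by
  obtain ⟨hbox, h1, h2, h3, h4⟩ := hp
  exact ⟨swap_mem_boxPlaq hbox, h1, h3, h2, by rwa [add_right_comm]⟩

/-- **The punctured block is simply connected — second route**: the extended axial gauge is a spanning forest and the block peels
in it (`nicePeeling`), so print's «simply connected» follows («We assign ε to a sufficient number of additional bonds to define an
axial gauge in each nice block» ⇒ step 2)); p32's `simplyConnected_boxMinusBox` by slabs is not used.
[cite: Federbush1987PhaseCellIII, §5.3 2)–3) p. 303] -/
theorem simplyConnected_boxMinusBox' (hK : ∀ i, lo i < klo i ∧ klo i ≤ khi i ∧ khi i < hi i) :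
    SimplyConnected (puncturedPlaq lo hi klo khi) (puncturedBonds lo hi klo khi) :=
  simplyConnected_of_peeling (nicePeeling hK) niceTree_subset (spans_niceTree hK) (isForest_niceTree hK)
    fun _ hp => swap_mem_puncturedPlaq hp

end Punctured

/-! ## §4 «This could not be done in two dimensions»: no spanning-forest gauge of the punctured plane is peelable -/

section DimTwo

variable {P : Set (LatticeContour.Plaq d)} {Λ T : Set (Bond d)} {x₀ : Site d}

/-- **Not simply connected ⇒ not normally generated** (any spanning forest gauge, orientation-closed plaquettes).
[cite: Federbush1987PhaseCellIII, §5.3 2) p. 303] -/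
theorem not_normallyGenerated_of_not_simplyConnected (hsc : ¬ SimplyConnected P Λ) (hTΛ : T ⊆ Λ) (hspan : Spans T Λ x₀)
    (hT : IsForest T) (hPs : ∀ p ∈ P, (p.1, p.2.2, p.2.1) ∈ P) : ¬ NormallyGenerated P Λ T :=
  fun h => hsc (simplyConnected_of_normallyGenerated hTΛ hspan hT hPs h)

/-- **Not simply connected ⇒ NOT PEELABLE** in any spanning forest gauge. [cite: Federbush1987PhaseCellIII, §5.3 2)–3) p. 303] -/
theorem isEmpty_peeling_of_not_simplyConnected (hsc : ¬ SimplyConnected P Λ) (hTΛ : T ⊆ Λ) (hspan : Spans T Λ x₀)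
    (hT : IsForest T) (hPs : ∀ p ∈ P, (p.1, p.2.2, p.2.1) ∈ P) : IsEmpty (Peeling P Λ T) :=
  ⟨fun π => hsc (simplyConnected_of_peeling π hTΛ hspan hT hPs)⟩

/-- **The punctured plane admits no peelable spanning-forest gauge**: with the four plaquettes cornered at `z₀` removed from `ℤ²`
(p32's `not_simplyConnected_puncturedPlane`: winding number), NO forest `T` spanning all bonds of `ℤ²` carries a peeling — the
peeling reading of «(This could not be done in two dimensions.)». [cite: Federbush1987PhaseCellIII, §5.3 2) p. 303] -/
theorem isEmpty_peeling_puncturedPlane (z₀ : Site 2) {T : Set (Bond 2)} {x₀ : Site 2} (hT : IsForest T)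
    (hspan : Spans T (Set.univ : Set (Bond 2)) x₀) :
    IsEmpty (Peeling {q : LatticeContour.Plaq 2 | q.1 ≠ z₀} (Set.univ : Set (Bond 2)) T) :=
  isEmpty_peeling_of_not_simplyConnected (not_simplyConnected_puncturedPlane z₀) (Set.subset_univ T) hspan hT
    fun _ hq => hq

/-- … nor do the based plaquette words of the punctured plane normally generate, in any spanning forest gauge.
[cite: Federbush1987PhaseCellIII, §5.3 2) p. 303] -/
theorem not_normallyGenerated_puncturedPlane (z₀ : Site 2) {T : Set (Bond 2)} {x₀ : Site 2} (hT : IsForest T)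
    (hspan : Spans T (Set.univ : Set (Bond 2)) x₀) :
    ¬ NormallyGenerated {q : LatticeContour.Plaq 2 | q.1 ≠ z₀} (Set.univ : Set (Bond 2)) T :=
  not_normallyGenerated_of_not_simplyConnected (not_simplyConnected_puncturedPlane z₀) (Set.subset_univ T) hspan hT fun _ hq => hq

end DimTwo

end ObservationCriterion

end Literature.MathematicalPhysics.QuantumFieldTheory.Federbush1986
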